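import Literature.NumberTheory.Automorphic.GodementJacquetTruncatedZeta
import Literature.NumberTheory.Automorphic.GodementJacquetThetaSeries
import HarnessLib

/-!
# The kernel of the truncated zeta integral as an `A_G`-integral of the regular theta series,
# the dual test function, and the pointwise reflection formula

Topic `NumberTheory/Automorphic`; namespace `Literature.NumberTheory.Automorphic`. A brick of the
discharge of `GodementJacquet1972_gjZeta_meromorphic` (Godement–Jacquet, LNM 260 (1972), §12:
after unfolding, the kernel of `Z^{<1}` is `∫_{A_G} |det|^s Σ_{ξ ∈ GL_n(K)} Φ(h⁻¹ ξ a g) da`, to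
which Poisson summation is applied fibrewise). On `GodementJacquetTruncatedZeta` (`gjTruncF`),
`GodementJacquetThetaSeries` (`gjTheta*`, the reflection formula) and `GLnZetaKernel` (the kernel on
`H = A_G · GL_n(K)`):

* weight algebra: `gjTruncF_eq_mul_gjTruncF_one` (`F_s^< = Φ · ω_s`, `ω_s = gjTruncF n K 1 s`),
  `adelicAbsDet_eq_one_of_mem_arithmeticSubgroup` (`|det γ|_𝔸 = 1` on `GL_n(K)`),
  `tsum_gjTruncF_arith_eq_mul_gjThetaReg` (**`Σ_γ F_s^<(x γ a b) = ω_s(x a b) Θ_Φ^reg(x, a b)`**);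
* `detGtOne`, `gjDualF n K Ψ w = Ψ |det|^w 𝟙_{|det| > 1}` (**definitions**: the dual test
  function, for `Ψ = Φ̂`, `w = n - s`), `integrable_gjDualF` (**`∈ L¹` for `Re w ≤ n² + n + 2`**),
  `tsum_gjDualF_arith_eq_mul_gjThetaReg`;
* `gjTruncF_one_mul_pow_eq_gjDualF_one` — the weight reflection `ω_s(g) |det g⁻¹|ⁿ = ω'_{n-s}(g⁻¹)`;
  `gjTruncF_one_mul_gjThetaReg_eq_reflection` — **the pointwise reflection of one fibre term**
  `ω_s(x a y⁻¹) Θ_Φ^reg(x, a y⁻¹) = λ(D_M)⁻¹ ω'_{n-s}(y a⁻¹ x⁻¹) (Θ_{Φ̂}^reg + Θ_{Φ̂}^sing)(y a⁻¹, x⁻¹)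
   - ω_s(x a y⁻¹) Θ_Φ^sing(x, a y⁻¹)`;
* `centerval_mul_comm`, `gjThetaReg_central_mul`, `gjThetaSing_central_mul` — `A_G` is central in
  `M_n(𝔸_K)` and moves freely between the two arguments of the theta series;
* `cosetKernel_gjTruncF_eq_smul_integral_gjThetaReg` — **the kernel of `F_s^<`** on an integrable
  fibre: `K_{F_s^<}(x̃, ỹH) = κ ∫_{A_G} ω_s(x̃ a ỹ⁻¹) Θ_Φ^reg(x̃, a ỹ⁻¹) dα`;
  `cosetKernel_gjDualF_eq_smul_integral_gjThetaReg` — the same for `F'_w`; and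
  `integral_gjDualF_one_mul_gjThetaReg_eq_integral_inv` — the dual fibre integral in reflected
  variables (`a ↦ a⁻¹`, centrality), matching the dual regular term of the pointwise reflection.

Everything is proved; measures enter only through the hypotheses of `GLnZetaKernel`
(`ρ_H ↦ κ (α ⊗ #)`, `α` an inversion-invariant Haar measure on `A_G`).

## References

* R. Godement, H. Jacquet, *Zeta functions of simple algebras*, LNM 260 (1972), §12–13
  [GodementJacquet1972].
* H. Jacquet, *Principal L-functions of the linear group*, Proc. Sympos. Pure Math. 33.2 (1979), §4
  [folklore].
-/

noncomputable section

open MeasureTheory Measure Set Filter Topology IsDedekindDomain NumberField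
open Literature.MeasureTheory.Group
open scoped ENNReal NNReal ComplexConjugate MatrixGroups

namespace Literature.NumberTheory.Automorphic

-- the quotient carries the tree's Borel σ-algebra, not Mathlib's quotient σ-algebra
attribute [-instance] Quotient.instMeasurableSpace QuotientGroup.measurableSpace

section WeightAlgebra

variable {n : ℕ} {K : Type} [Field K] [NumberField K]

/-- **`F_s^< = Φ · ω_s`** with the weight `ω_s = gjTruncF n K 1 s = |det|^s 𝟙_{|det| < 1}`: 
`gjTruncF n K Φ s g = Φ(g) · gjTruncF n K (fun _ => 1) s g`. [folklore] -/
theorem gjTruncF_eq_mul_gjTruncF_one (Φ : Matrix (Fin n) (Fin n) (AdeleRing (𝓞 K) K) → ℂ) (s : ℂ)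
    (g : GL (Fin n) (AdeleRing (𝓞 K) K)) :
    gjTruncF n K Φ s g = Φ (g : Matrix (Fin n) (Fin n) (AdeleRing (𝓞 K) K)) * gjTruncF n K (fun _ => 1) s g := by
  rw [gjTruncF_apply, gjTruncF_apply]
  by_cases hg : g ∈ (detAtLeastOne n K)ᶜ
  · rw [Set.indicator_of_mem hg, Set.indicator_of_mem hg, one_mul]
  · rw [Set.indicator_of_notMem hg, Set.indicator_of_notMem hg, mul_zero]

/-- **The weight `ω_s(g)` only depends on `|det g|_𝔸`.** [folklore] -/
theorem gjTruncF_one_eq_of_adelicAbsDet_eq (s : ℂ) {g g' : GL (Fin n) (AdeleRing (𝓞 K) K)}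
    (h : adelicAbsDet n K g = adelicAbsDet n K g') :
    gjTruncF n K (fun _ => (1 : ℂ)) s g = gjTruncF n K (fun _ => (1 : ℂ)) s g' := by
  rw [gjTruncF_apply, gjTruncF_apply]
  have hmem : g ∈ (detAtLeastOne n K)ᶜ ↔ g' ∈ (detAtLeastOne n K)ᶜ := by
    simp only [Set.mem_compl_iff, mem_detAtLeastOne_iff, h]
  by_cases hg : g ∈ (detAtLeastOne n K)ᶜ
  · rw [Set.indicator_of_mem hg, Set.indicator_of_mem (hmem.1 hg), h]
  · rw [Set.indicator_of_notMem hg, Set.indicator_of_notMem (fun h' => hg (hmem.2 h'))]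

/-- **`|det γ|_𝔸 = 1` on the arithmetic subgroup** (product formula;
`glAbsDet_eq_one_of_mem_rationalPointsGL`). [folklore] -/
theorem adelicAbsDet_eq_one_of_mem_arithmeticSubgroup {γ : GL (Fin n) (AdeleRing (𝓞 K) K)}
    (hγ : γ ∈ (AdelicGroupData.gl n K).arithmeticSubgroup) : adelicAbsDet n K γ = 1 := by
  have h := glAbsDet_eq_one_of_mem_rationalPointsGL (n := n) (K := K)
    (γ := γ) (by rw [rationalPointsGL_eq_arithmeticSubgroup]; exact hγ)
  rw [show adelicAbsDet n K γ = ((glAbsDet n K γ : ℝ≥0ˣ) : ℝ≥0) from rfl, h, Units.val_one]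

/-- `|det (x γ a y)|_𝔸 = |det (x a y)|_𝔸` for `γ` in the arithmetic subgroup. [folklore] -/
theorem adelicAbsDet_mul_arith_mul_mul {γ : GL (Fin n) (AdeleRing (𝓞 K) K)}
    (hγ : γ ∈ (AdelicGroupData.gl n K).arithmeticSubgroup) (x a y : GL (Fin n) (AdeleRing (𝓞 K) K)) :
    adelicAbsDet n K (x * γ * a * y) = adelicAbsDet n K (x * a * y) := by
  simp only [map_mul, adelicAbsDet_eq_one_of_mem_arithmeticSubgroup hγ, mul_one]

/-- Matrix of a fourfold product in `GL_n`: `↑(x γ a b) = ↑x ↑γ ↑(a b)`. [folklore] -/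
theorem coe_mul_mul_mul_eq (x g a b : GL (Fin n) (AdeleRing (𝓞 K) K)) :
    ((x * g * a * b : GL (Fin n) (AdeleRing (𝓞 K) K)) : Matrix (Fin n) (Fin n) (AdeleRing (𝓞 K) K)) =
      (x : Matrix (Fin n) (Fin n) (AdeleRing (𝓞 K) K)) * (g : Matrix (Fin n) (Fin n) (AdeleRing (𝓞 K) K)) *
        ((a * b : GL (Fin n) (AdeleRing (𝓞 K) K)) : Matrix (Fin n) (Fin n) (AdeleRing (𝓞 K) K)) := by
  simp only [Units.val_mul, Matrix.mul_assoc]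

/-- One term: `F_s^<(x γ a b) = Φ(↑x ↑γ ↑(a b)) · ω_s(x a b)` for `γ` arithmetic. [folklore] -/
theorem gjTruncF_mul_arith_eq (Φ : Matrix (Fin n) (Fin n) (AdeleRing (𝓞 K) K) → ℂ) (s : ℂ)
    (x a b : GL (Fin n) (AdeleRing (𝓞 K) K)) {γ : GL (Fin n) (AdeleRing (𝓞 K) K)}
    (hγ : γ ∈ (AdelicGroupData.gl n K).arithmeticSubgroup) :
    gjTruncF n K Φ s (x * γ * a * b) =
      Φ ((x : Matrix (Fin n) (Fin n) (AdeleRing (𝓞 K) K)) * (γ : Matrix (Fin n) (Fin n) (AdeleRing (𝓞 K) K)) *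
        ((a * b : GL (Fin n) (AdeleRing (𝓞 K) K)) : Matrix (Fin n) (Fin n) (AdeleRing (𝓞 K) K))) *
      gjTruncF n K (fun _ => (1 : ℂ)) s (x * a * b) := by
  rw [gjTruncF_eq_mul_gjTruncF_one, coe_mul_mul_mul_eq,
    gjTruncF_one_eq_of_adelicAbsDet_eq s (adelicAbsDet_mul_arith_mul_mul hγ x a b)]

/-- **The fibre sum of the truncated test function is the weight times the regular theta series**:
`Σ_{γ ∈ GL_n(K)} F_s^<(x γ a b) = ω_s(x a b) · Θ_Φ^reg(x, a b)` (`|det γ|_𝔸 = 1`; products in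
`(AdelicGroupData.gl n K).Adelic = GL_n(𝔸_K)`, the form delivered by `GLnZetaKernel`). [folklore] -/
theorem tsum_gjTruncF_arith_eq_mul_gjThetaReg (Φ : Matrix (Fin n) (Fin n) (AdeleRing (𝓞 K) K) → ℂ) (s : ℂ)
    (x a b : (AdelicGroupData.gl n K).Adelic) :
    ∑' γ : (AdelicGroupData.gl n K).arithmeticSubgroup,
        gjTruncF n K Φ s (x * (γ : (AdelicGroupData.gl n K).Adelic) * a * b) =
      gjTruncF n K (fun _ => (1 : ℂ)) s (x * a * b) * gjThetaReg n K Φ x (a * b) := by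
  have h1 : ∀ γ : (AdelicGroupData.gl n K).arithmeticSubgroup,
      gjTruncF n K Φ s (x * (γ : (AdelicGroupData.gl n K).Adelic) * a * b) =
        gjTruncF n K (fun _ => (1 : ℂ)) s (x * a * b) *
          Φ (Units.val x * Units.val (γ : (AdelicGroupData.gl n K).Adelic) * Units.val (a * b)) :=
    fun γ => (gjTruncF_mul_arith_eq Φ s x a b γ.2).trans (mul_comm _ _)
  rw [tsum_congr h1, tsum_mul_left]
  congr 1
  exact (gjThetaReg_eq_tsum_arithmeticSubgroup Φ x (a * b)).symm

end WeightAlgebra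

/-! ### The dual weight `ω'_w = |det|^w 𝟙_{|det| > 1}` and the reflection of one fibre term -/

section Dual

variable (n : ℕ) (K : Type) [Field K] [NumberField K]

/-- The region `{|det x|_𝔸 > 1}` of `GL_n(𝔸_K)` (the image of `{|det| < 1}` under `x ↦ x⁻¹`). [folklore] -/
def detGtOne : Set (GL (Fin n) (AdeleRing (𝓞 K) K)) := {x | 1 < (adelicAbsDet n K x : ℝ)}

/-- **The dual truncated test function** `F'_w(u) = Ψ(u) |det u|_𝔸^w 𝟙_{|det u|_𝔸 > 1}` (for `Ψ = Φ̂`,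
`w = n - s`: the integrand of the reflected zeta integral, Godement–Jacquet (1972), §13). [folklore] -/
def gjDualF (Ψ : Matrix (Fin n) (Fin n) (AdeleRing (𝓞 K) K) → ℂ) (w : ℂ) (u : GL (Fin n) (AdeleRing (𝓞 K) K)) : ℂ :=
  (detGtOne n K).indicator
    (fun u => Ψ (u : Matrix (Fin n) (Fin n) (AdeleRing (𝓞 K) K)) * ((adelicAbsDet n K u : ℝ) : ℂ) ^ w) u

variable {n K}

/-- Membership in `detGtOne` (definitional). [folklore] -/
theorem mem_detGtOne_iff (x : GL (Fin n) (AdeleRing (𝓞 K) K)) :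
    x ∈ detGtOne n K ↔ 1 < (adelicAbsDet n K x : ℝ) := Iff.rfl

/-- `detGtOne` is open. [folklore] -/
theorem isOpen_detGtOne : IsOpen (detGtOne n K) :=
  isOpen_lt continuous_const continuous_adelicAbsDet

/-- `x⁻¹ ∈ {|det| > 1}` iff `x ∈ {|det| < 1}`. [folklore] -/
theorem inv_mem_detGtOne_iff (x : GL (Fin n) (AdeleRing (𝓞 K) K)) :
    x⁻¹ ∈ detGtOne n K ↔ x ∈ (detAtLeastOne n K)ᶜ := by
  rw [mem_detGtOne_iff, Set.mem_compl_iff, mem_detAtLeastOne_iff, not_le, map_inv, NNReal.coe_inv]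
  exact one_lt_inv₀ (adelicAbsDet_pos x)

/-- Unfolding of `gjDualF`. [folklore] -/
theorem gjDualF_apply (Ψ : Matrix (Fin n) (Fin n) (AdeleRing (𝓞 K) K) → ℂ) (w : ℂ)
    (u : GL (Fin n) (AdeleRing (𝓞 K) K)) :
    gjDualF n K Ψ w u = (detGtOne n K).indicator
      (fun u => Ψ (u : Matrix (Fin n) (Fin n) (AdeleRing (𝓞 K) K)) * ((adelicAbsDet n K u : ℝ) : ℂ) ^ w) u := rfl

/-- `F'_w = Ψ · ω'_w`. [folklore] -/
theorem gjDualF_eq_mul_gjDualF_one (Ψ : Matrix (Fin n) (Fin n) (AdeleRing (𝓞 K) K) → ℂ) (w : ℂ)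
    (u : GL (Fin n) (AdeleRing (𝓞 K) K)) :
    gjDualF n K Ψ w u = Ψ (u : Matrix (Fin n) (Fin n) (AdeleRing (𝓞 K) K)) * gjDualF n K (fun _ => 1) w u := by
  rw [gjDualF_apply, gjDualF_apply]
  by_cases hu : u ∈ detGtOne n K
  · rw [Set.indicator_of_mem hu, Set.indicator_of_mem hu, one_mul]
  · rw [Set.indicator_of_notMem hu, Set.indicator_of_notMem hu, mul_zero]

/-- The dual weight only depends on `|det|_𝔸`. [folklore] -/
theorem gjDualF_one_eq_of_adelicAbsDet_eq (w : ℂ) {u u' : GL (Fin n) (AdeleRing (𝓞 K) K)}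
    (h : adelicAbsDet n K u = adelicAbsDet n K u') :
    gjDualF n K (fun _ => (1 : ℂ)) w u = gjDualF n K (fun _ => (1 : ℂ)) w u' := by
  rw [gjDualF_apply, gjDualF_apply]
  have hmem : u ∈ detGtOne n K ↔ u' ∈ detGtOne n K := by
    simp only [mem_detGtOne_iff, h]
  by_cases hu : u ∈ detGtOne n K
  · rw [Set.indicator_of_mem hu, Set.indicator_of_mem (hmem.1 hu), h]
  · rw [Set.indicator_of_notMem hu, Set.indicator_of_notMem (fun h' => hu (hmem.2 h'))]

/-- **The weight reflection** `ω_s(g) · |det g⁻¹|_𝔸ⁿ = ω'_{n-s}(g⁻¹)`: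
`|det g|^s 𝟙_{|det g|<1} · |det g|⁻ⁿ = |det g⁻¹|^{n-s} 𝟙_{|det g⁻¹|>1}`. [folklore] -/
theorem gjTruncF_one_mul_pow_eq_gjDualF_one (s : ℂ) (g : GL (Fin n) (AdeleRing (𝓞 K) K)) :
    gjTruncF n K (fun _ => (1 : ℂ)) s g * (((adelicAbsDet n K g⁻¹ : ℝ≥0) : ℝ) : ℂ) ^ (n : ℕ) =
      gjDualF n K (fun _ => (1 : ℂ)) ((n : ℂ) - s) g⁻¹ := by
  rw [gjTruncF_apply, gjDualF_apply]
  have hpos : (0 : ℝ) < (adelicAbsDet n K g : ℝ) := adelicAbsDet_pos g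
  have hne : ((adelicAbsDet n K g : ℝ) : ℂ) ≠ 0 := by exact_mod_cast hpos.ne'
  have harg : ((adelicAbsDet n K g : ℝ) : ℂ).arg ≠ Real.pi := by
    rw [Complex.arg_ofReal_of_nonneg hpos.le]; exact Real.pi_pos.ne
  by_cases hg : g ∈ (detAtLeastOne n K)ᶜ
  · rw [Set.indicator_of_mem hg, Set.indicator_of_mem ((inv_mem_detGtOne_iff g).2 hg), one_mul, one_mul,
      map_inv, NNReal.coe_inv, Complex.ofReal_inv, Complex.inv_cpow _ _ harg, ← Complex.cpow_neg,
      inv_pow, ← Complex.cpow_natCast, ← Complex.cpow_neg, ← Complex.cpow_add _ _ hne]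
    congr 1
    ring
  · rw [Set.indicator_of_notMem hg, Set.indicator_of_notMem (fun h => hg ((inv_mem_detGtOne_iff g).1 h)),
      zero_mul]

/-- **`|det (A B)⁻¹|ⁿ = |det A⁻¹|ⁿ |det B⁻¹|ⁿ` as complex numbers** (bookkeeping for the reflection
factor of `gjTheta_eq_smul_gjTheta_adelicMatrixFourier`). [folklore] -/
theorem coe_adelicAbsDet_inv_pow_mul (A B : GL (Fin n) (AdeleRing (𝓞 K) K)) :
    (((adelicAbsDet n K A⁻¹ ^ n * adelicAbsDet n K B⁻¹ ^ n : ℝ≥0)) : ℂ) =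
      (((adelicAbsDet n K (A * B)⁻¹ : ℝ≥0) : ℝ) : ℂ) ^ (n : ℕ) := by
  rw [mul_inv_rev, map_mul]
  push_cast
  ring

/-- **Reflection of one fibre term** (pointwise in `a`): for `Φ ∈ 𝒮(M_n(𝔸_K))`, `x, y, a ∈ GL_n(𝔸_K)`,
with `Φ̂ = adelicMatrixFourier n K λ Φ`,
`ω_s(x a y⁻¹) Θ_Φ^reg(x, a y⁻¹) = λ(D_M)⁻¹ ω'_{n-s}(y a⁻¹ x⁻¹) (Θ_{Φ̂}^reg(y a⁻¹, x⁻¹) + Θ_{Φ̂}^sing(y a⁻¹, x⁻¹))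
   - ω_s(x a y⁻¹) Θ_Φ^sing(x, a y⁻¹)`
(`gjThetaReg_eq_reflection` and `gjTruncF_one_mul_pow_eq_gjDualF_one`). [cite: GodementJacquet1972, §12] -/
theorem gjTruncF_one_mul_gjThetaReg_eq_reflection
    [MeasurableSpace (AdeleRing (𝓞 K) K)] [BorelSpace (AdeleRing (𝓞 K) K)]
    [MeasurableSpace (Matrix (Fin n) (Fin n) (AdeleRing (𝓞 K) K))] [BorelSpace (Matrix (Fin n) (Fin n) (AdeleRing (𝓞 K) K))]
    (lam : Measure (Matrix (Fin n) (Fin n) (AdeleRing (𝓞 K) K))) [lam.IsAddHaarMeasure] [lam.Regular]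
    {Φ : Matrix (Fin n) (Fin n) (AdeleRing (𝓞 K) K) → ℂ} (hΦ : Φ ∈ schwartzBruhatAdelicMatrix n K) (s : ℂ)
    (x a y : GL (Fin n) (AdeleRing (𝓞 K) K)) :
    gjTruncF n K (fun _ => (1 : ℂ)) s (x * a * y⁻¹) * gjThetaReg n K Φ x (a * y⁻¹) =
      (lam (matrixFundamentalDomain n K)).toReal⁻¹ *
        (gjDualF n K (fun _ => (1 : ℂ)) ((n : ℂ) - s) (y * a⁻¹ * x⁻¹) *
          (gjThetaReg n K (adelicMatrixFourier n K lam Φ) (y * a⁻¹) x⁻¹ +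
            gjThetaSing n K (adelicMatrixFourier n K lam Φ) (y * a⁻¹) x⁻¹)) -
        gjTruncF n K (fun _ => (1 : ℂ)) s (x * a * y⁻¹) * gjThetaSing n K Φ x (a * y⁻¹) := by
  rw [gjThetaReg_eq_reflection lam hΦ x (a * y⁻¹), coe_adelicAbsDet_inv_pow_mul,
    show x * (a * y⁻¹) = x * a * y⁻¹ by rw [mul_assoc],
    show (a * y⁻¹)⁻¹ = y * a⁻¹ by rw [mul_inv_rev, inv_inv],
    show (x * a * y⁻¹)⁻¹ = y * a⁻¹ * x⁻¹ by rw [mul_inv_rev, mul_inv_rev, inv_inv, mul_assoc]]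
  have hw := gjTruncF_one_mul_pow_eq_gjDualF_one (n := n) (K := K) s (x * a * y⁻¹)
  rw [show (x * a * y⁻¹)⁻¹ = y * a⁻¹ * x⁻¹ by rw [mul_inv_rev, mul_inv_rev, inv_inv, mul_assoc]] at hw
  rw [← hw]
  ring

/-- `|det (y γ a b)|_𝔸`-bookkeeping for the dual weight: one term
`F'_w(y γ a b) = Ψ(↑y ↑γ ↑(a b)) · ω'_w(y a b)` for `γ` arithmetic. [folklore] -/
theorem gjDualF_mul_arith_eq (Ψ : Matrix (Fin n) (Fin n) (AdeleRing (𝓞 K) K) → ℂ) (w : ℂ)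
    (y a b : GL (Fin n) (AdeleRing (𝓞 K) K)) {γ : GL (Fin n) (AdeleRing (𝓞 K) K)}
    (hγ : γ ∈ (AdelicGroupData.gl n K).arithmeticSubgroup) :
    gjDualF n K Ψ w (y * γ * a * b) =
      Ψ ((y : Matrix (Fin n) (Fin n) (AdeleRing (𝓞 K) K)) * (γ : Matrix (Fin n) (Fin n) (AdeleRing (𝓞 K) K)) *
        ((a * b : GL (Fin n) (AdeleRing (𝓞 K) K)) : Matrix (Fin n) (Fin n) (AdeleRing (𝓞 K) K))) *
      gjDualF n K (fun _ => (1 : ℂ)) w (y * a * b) := by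
  rw [gjDualF_eq_mul_gjDualF_one, coe_mul_mul_mul_eq,
    gjDualF_one_eq_of_adelicAbsDet_eq w (adelicAbsDet_mul_arith_mul_mul hγ y a b)]

/-- **The fibre sum of the dual test function**:
`Σ_{γ ∈ GL_n(K)} F'_w(y γ a b) = ω'_w(y a b) · Θ_Ψ^reg(y, a b)`. [folklore] -/
theorem tsum_gjDualF_arith_eq_mul_gjThetaReg (Ψ : Matrix (Fin n) (Fin n) (AdeleRing (𝓞 K) K) → ℂ) (w : ℂ)
    (y a b : (AdelicGroupData.gl n K).Adelic) :
    ∑' γ : (AdelicGroupData.gl n K).arithmeticSubgroup,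
        gjDualF n K Ψ w (y * (γ : (AdelicGroupData.gl n K).Adelic) * a * b) =
      gjDualF n K (fun _ => (1 : ℂ)) w (y * a * b) * gjThetaReg n K Ψ y (a * b) := by
  have h1 : ∀ γ : (AdelicGroupData.gl n K).arithmeticSubgroup,
      gjDualF n K Ψ w (y * (γ : (AdelicGroupData.gl n K).Adelic) * a * b) =
        gjDualF n K (fun _ => (1 : ℂ)) w (y * a * b) *
          Ψ (Units.val y * Units.val (γ : (AdelicGroupData.gl n K).Adelic) * Units.val (a * b)) :=
    fun γ => (gjDualF_mul_arith_eq Ψ w y a b γ.2).trans (mul_comm _ _)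
  rw [tsum_congr h1, tsum_mul_left]
  congr 1
  exact (gjThetaReg_eq_tsum_arithmeticSubgroup Ψ y (a * b)).symm

/-- **Elements of the split centre `A_G` are central in the matrix algebra `M_n(𝔸_K)`** (they are
the scalar matrices of positive real ideles). [folklore] -/
theorem centerval_mul_comm (a : (AdelicGroupData.gl n K).center')
    (M : Matrix (Fin n) (Fin n) (AdeleRing (𝓞 K) K)) :
    Units.val (a : (AdelicGroupData.gl n K).Adelic) * M = M * Units.val (a : (AdelicGroupData.gl n K).Adelic) := by
  obtain ⟨t, ht⟩ := a.2
  have hval : Units.val (a : (AdelicGroupData.gl n K).Adelic) =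
      Matrix.scalar (Fin n) ((posRealIdele K t : (AdeleRing (𝓞 K) K)ˣ) : AdeleRing (𝓞 K) K) := by
    rw [← ht]; rfl
  rw [hval]
  exact (Matrix.scalar_commute _ (fun r => Commute.all _ r) M).eq

/-- **The regular theta series absorbs central matrices on either side**:
`Θ_Ψ^reg(y, a B) = Θ_Ψ^reg(y a, B)` when `↑a` commutes with all matrices (e.g. `a ∈ A_G`,
`centerval_mul_comm`). [folklore] -/
theorem gjThetaReg_central_mul (Ψ : Matrix (Fin n) (Fin n) (AdeleRing (𝓞 K) K) → ℂ)
    (y B : GL (Fin n) (AdeleRing (𝓞 K) K)) {a : GL (Fin n) (AdeleRing (𝓞 K) K)}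
    (ha : ∀ M : Matrix (Fin n) (Fin n) (AdeleRing (𝓞 K) K),
      (a : Matrix (Fin n) (Fin n) (AdeleRing (𝓞 K) K)) * M = M * a) :
    gjThetaReg n K Ψ y (a * B) = gjThetaReg n K Ψ (y * a) B := by
  unfold gjThetaReg
  refine tsum_congr fun ξ => ?_
  have hm : (y : Matrix (Fin n) (Fin n) (AdeleRing (𝓞 K) K)) * ratMatrix n K ξ *
      ((a : Matrix (Fin n) (Fin n) (AdeleRing (𝓞 K) K)) * B) =
      (y : Matrix (Fin n) (Fin n) (AdeleRing (𝓞 K) K)) * a * ratMatrix n K ξ * B := by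
    rw [← Matrix.mul_assoc, Matrix.mul_assoc _ (ratMatrix n K (ξ : Matrix (Fin n) (Fin n) K)),
      ← ha, ← Matrix.mul_assoc]
  simp only [Units.val_mul]
  rw [hm]

/-- The same for the singular part: `Θ_Ψ^sing(y, a B) = Θ_Ψ^sing(y a, B)`. [folklore] -/
theorem gjThetaSing_central_mul (Ψ : Matrix (Fin n) (Fin n) (AdeleRing (𝓞 K) K) → ℂ)
    (y B : GL (Fin n) (AdeleRing (𝓞 K) K)) {a : GL (Fin n) (AdeleRing (𝓞 K) K)}
    (ha : ∀ M : Matrix (Fin n) (Fin n) (AdeleRing (𝓞 K) K),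
      (a : Matrix (Fin n) (Fin n) (AdeleRing (𝓞 K) K)) * M = M * a) :
    gjThetaSing n K Ψ y (a * B) = gjThetaSing n K Ψ (y * a) B := by
  unfold gjThetaSing
  refine tsum_congr fun ξ => ?_
  have hm : (y : Matrix (Fin n) (Fin n) (AdeleRing (𝓞 K) K)) * ratMatrix n K ξ *
      ((a : Matrix (Fin n) (Fin n) (AdeleRing (𝓞 K) K)) * B) =
      (y : Matrix (Fin n) (Fin n) (AdeleRing (𝓞 K) K)) * a * ratMatrix n K ξ * B := by
    rw [← Matrix.mul_assoc, Matrix.mul_assoc _ (ratMatrix n K (ξ : Matrix (Fin n) (Fin n) K)),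
      ← ha, ← Matrix.mul_assoc]
  simp only [Units.val_mul]
  rw [hm]

end Dual

/-! ### `F'_w ∈ L¹(GL_n(𝔸_K))` for `Re w ≤ n² + n + 2` -/

section DualIntegrable

variable {n : ℕ} {K : Type} [Field K] [NumberField K]

attribute [local instance] adelicBorel borelSpace_adelic locallyCompactSpace_adelic
  secondCountableTopology_gl_adelic glBorel borelSpace_glBorel isHaarMeasure_glForm

/-- `|F'_w(u)| ≤ 𝟙_{|det u| ≥ 1} |Ψ(u)| |det u|^{Re w}`. [folklore] -/
theorem norm_gjDualF_le_indicator (Ψ : Matrix (Fin n) (Fin n) (AdeleRing (𝓞 K) K) → ℂ) (w : ℂ)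
    (u : GL (Fin n) (AdeleRing (𝓞 K) K)) :
    ‖gjDualF n K Ψ w u‖ ≤ (detAtLeastOne n K).indicator
      (fun u : GL (Fin n) (AdeleRing (𝓞 K) K) =>
        ‖Ψ (u : Matrix (Fin n) (Fin n) (AdeleRing (𝓞 K) K))‖ * (adelicAbsDet n K u : ℝ) ^ w.re) u := by
  rw [gjDualF_apply]
  by_cases hu : u ∈ detGtOne n K
  · have hu' : u ∈ detAtLeastOne n K := by
      rw [mem_detAtLeastOne_iff]; exact (le_of_lt ((mem_detGtOne_iff u).1 hu))
    rw [Set.indicator_of_mem hu, Set.indicator_of_mem hu', norm_mul,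
      Complex.norm_cpow_eq_rpow_re_of_pos (adelicAbsDet_pos u)]
  · rw [Set.indicator_of_notMem hu, norm_zero]
    exact Set.indicator_nonneg (fun v _ => by positivity) u

/-- `F'_w` is a.e. strongly measurable. [folklore] -/
theorem aestronglyMeasurable_gjDualF {Ψ : Matrix (Fin n) (Fin n) (AdeleRing (𝓞 K) K) → ℂ}
    (hΨ : Ψ ∈ schwartzBruhatAdelicMatrix n K) (w : ℂ) (ν : Measure (AdelicGroupData.gl n K).Adelic) :
    AEStronglyMeasurable (gjDualF n K Ψ w) ν := by
  have hc : Continuous fun u : GL (Fin n) (AdeleRing (𝓞 K) K) =>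
      Ψ (u : Matrix (Fin n) (Fin n) (AdeleRing (𝓞 K) K)) * ((adelicAbsDet n K u : ℝ) : ℂ) ^ w :=
    ((continuous_of_mem_schwartzBruhatAdelicMatrix hΨ).comp Units.continuous_val).mul
      (continuous_adelicAbsDet_cpow w)
  exact hc.aestronglyMeasurable.indicator (isOpen_detGtOne (n := n) (K := K)).measurableSet

/-- **`F'_w = Ψ |det|^w 𝟙_{|det| > 1} ∈ L¹(GL_n(𝔸_K))` for `Ψ ∈ 𝒮(M_n(𝔸_K))` and `Re w ≤ n² + n + 2`**
(domination on `{|det| ≥ 1}` by the exponent `n² + n + 2`, integrable by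
`GodementJacquetGlobalConvergence`). In the application `Ψ = Φ̂`, `w = n - s` with `Re s` large, so
`Re w < 0 ≤ n² + n + 2`. [folklore] -/
theorem integrable_gjDualF {Ψ : Matrix (Fin n) (Fin n) (AdeleRing (𝓞 K) K) → ℂ}
    (hΨ : Ψ ∈ schwartzBruhatAdelicMatrix n K) {w : ℂ} (hw : w.re ≤ (n : ℝ) * n + n + 2)
    (ν : Measure (AdelicGroupData.gl n K).Adelic) [ν.IsHaarMeasure] :
    Integrable (gjDualF n K Ψ w) ν := by
  have h0 : Integrable (fun u : GL (Fin n) (AdeleRing (𝓞 K) K) =>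
      ‖Ψ (u : Matrix (Fin n) (Fin n) (AdeleRing (𝓞 K) K))‖ * (adelicAbsDet n K u : ℝ) ^ ((n : ℝ) * n + n + 2))
      ((ν : Measure (GL (Fin n) (AdeleRing (𝓞 K) K))).restrict (detAtLeastOne n K)) :=
    (integrable_norm_mul_adelicAbsDet_rpow_of_mem_schwartzBruhat
      (ν : Measure (GL (Fin n) (AdeleRing (𝓞 K) K))) hΨ le_rfl).mono_measure Measure.restrict_le_self
  have hΨc : Continuous fun u : GL (Fin n) (AdeleRing (𝓞 K) K) =>
      Ψ (u : Matrix (Fin n) (Fin n) (AdeleRing (𝓞 K) K)) :=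
    (continuous_of_mem_schwartzBruhatAdelicMatrix hΨ).comp Units.continuous_val
  have h1 := integrable_norm_mul_rpow_restrict_detAtLeastOne_of_le
    (ν := (ν : Measure (GL (Fin n) (AdeleRing (𝓞 K) K)))) hΨc.aestronglyMeasurable
    continuous_adelicAbsDet.aemeasurable hw h0
  have h2 : Integrable ((detAtLeastOne n K).indicator
      (fun u : GL (Fin n) (AdeleRing (𝓞 K) K) =>
        ‖Ψ (u : Matrix (Fin n) (Fin n) (AdeleRing (𝓞 K) K))‖ * (adelicAbsDet n K u : ℝ) ^ w.re))
      (ν : Measure (GL (Fin n) (AdeleRing (𝓞 K) K))) :=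
    (integrable_indicator_iff (measurableSet_detAtLeastOne (n := n) (K := K))).2 h1
  exact h2.mono' (aestronglyMeasurable_gjDualF hΨ w ν)
    (Eventually.of_forall (norm_gjDualF_le_indicator Ψ w))

end DualIntegrable

/-! ### The kernel of `F_s^<` on `H = A_G · GL_n(K)` as an `A_G`-integral of `ω_s · Θ^reg` -/

section Kernel

variable {n : ℕ} {K : Type} [Field K] [NumberField K]

attribute [local instance] adelicBorel borelSpace_adelic locallyCompactSpace_adelic
  secondCountableTopology_gl_adelic measurableSpaceQuotient borelSpaceQuotient glBorel borelSpace_glBorel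
  isHaarMeasure_glForm

/-- **The kernel of the truncated zeta integral**: on a fibre `(x̃, ỹ)` where `h ↦ F_s^<(x̃ h⁻¹ ỹ⁻¹)` is
`ρ_H`-integrable (`ae_integrable_gjTruncF_fiber`),
`K_{F_s^<}(x̃, ỹH) = κ ∫_{A_G} ω_s(x̃ a ỹ⁻¹) Θ_Φ^reg(x̃, a ỹ⁻¹) dα(a)`
(`cosetKernel_quotientSubgroup_eq_smul_integral_tsum` of `GLnZetaKernel` and
`tsum_gjTruncF_arith_eq_mul_gjThetaReg`; Godement–Jacquet (1972), §12, the kernel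
`∫_{A_G} |det|^s Σ_{ξ ∈ GL_n(K)} Φ(h⁻¹ ξ a g) da`). [cite: GodementJacquet1972, §12] -/
theorem cosetKernel_gjTruncF_eq_smul_integral_gjThetaReg
    {ρ : Measure (AdelicGroupData.gl n K).quotientSubgroup} [ρ.IsHaarMeasure]
    {α : Measure (AdelicGroupData.gl n K).center'} [α.IsHaarMeasure] [α.IsInvInvariant] {κ : ℝ≥0}
    (hκ : ρ.map (quotientSubgroupEquiv n K) =
      κ • α.prod (count : Measure (AdelicGroupData.gl n K).arithmeticSubgroup))
    (Φ : Matrix (Fin n) (Fin n) (AdeleRing (𝓞 K) K) → ℂ) (s : ℂ) (x₀ y₀ : (AdelicGroupData.gl n K).Adelic)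
    (hF : Integrable (fun h : (AdelicGroupData.gl n K).quotientSubgroup =>
      gjTruncF n K Φ s (x₀ * ((h : (AdelicGroupData.gl n K).Adelic))⁻¹ * y₀⁻¹)) ρ) :
    cosetKernel (AdelicGroupData.gl n K).quotientSubgroup ρ (gjTruncF n K Φ s) x₀ (QuotientGroup.mk y₀) =
      (κ : ℝ) • ∫ a : (AdelicGroupData.gl n K).center',
        gjTruncF n K (fun _ => (1 : ℂ)) s (x₀ * (a : (AdelicGroupData.gl n K).Adelic) * y₀⁻¹) *
          gjThetaReg n K Φ x₀ ((a : (AdelicGroupData.gl n K).Adelic) * y₀⁻¹) ∂α := by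
  rw [cosetKernel_quotientSubgroup_eq_smul_integral_tsum hκ (gjTruncF n K Φ s) x₀ y₀ hF]
  congr 1
  exact integral_congr_ae (Eventually.of_forall fun a =>
    tsum_gjTruncF_arith_eq_mul_gjThetaReg Φ s x₀ (a : (AdelicGroupData.gl n K).Adelic) y₀⁻¹)

/-- **The kernel of the dual test function**: on a fibre `(ỹ, x̃)` where `h ↦ F'_w(ỹ h⁻¹ x̃⁻¹)` is
`ρ_H`-integrable, `K_{F'_w}(ỹ, x̃H) = κ ∫_{A_G} ω'_w(ỹ a x̃⁻¹) Θ_Ψ^reg(ỹ, a x̃⁻¹) dα(a)`.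
[cite: GodementJacquet1972, §12] -/
theorem cosetKernel_gjDualF_eq_smul_integral_gjThetaReg
    {ρ : Measure (AdelicGroupData.gl n K).quotientSubgroup} [ρ.IsHaarMeasure]
    {α : Measure (AdelicGroupData.gl n K).center'} [α.IsHaarMeasure] [α.IsInvInvariant] {κ : ℝ≥0}
    (hκ : ρ.map (quotientSubgroupEquiv n K) =
      κ • α.prod (count : Measure (AdelicGroupData.gl n K).arithmeticSubgroup))
    (Ψ : Matrix (Fin n) (Fin n) (AdeleRing (𝓞 K) K) → ℂ) (w : ℂ) (y₀ x₀ : (AdelicGroupData.gl n K).Adelic)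
    (hF : Integrable (fun h : (AdelicGroupData.gl n K).quotientSubgroup =>
      gjDualF n K Ψ w (y₀ * ((h : (AdelicGroupData.gl n K).Adelic))⁻¹ * x₀⁻¹)) ρ) :
    cosetKernel (AdelicGroupData.gl n K).quotientSubgroup ρ (gjDualF n K Ψ w) y₀ (QuotientGroup.mk x₀) =
      (κ : ℝ) • ∫ a : (AdelicGroupData.gl n K).center',
        gjDualF n K (fun _ => (1 : ℂ)) w (y₀ * (a : (AdelicGroupData.gl n K).Adelic) * x₀⁻¹) *
          gjThetaReg n K Ψ y₀ ((a : (AdelicGroupData.gl n K).Adelic) * x₀⁻¹) ∂α := by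
  rw [cosetKernel_quotientSubgroup_eq_smul_integral_tsum hκ (gjDualF n K Ψ w) y₀ x₀ hF]
  congr 1
  exact integral_congr_ae (Eventually.of_forall fun a =>
    tsum_gjDualF_arith_eq_mul_gjThetaReg Ψ w y₀ (a : (AdelicGroupData.gl n K).Adelic) x₀⁻¹)

/-- **The dual kernel in reflected variables**: by `a ↦ a⁻¹` (inversion invariance of `α`) and the
centrality of `A_G`,
`∫_{A_G} ω'_w(ỹ a x̃⁻¹) Θ_Ψ^reg(ỹ, a x̃⁻¹) dα = ∫_{A_G} ω'_w(ỹ a⁻¹ x̃⁻¹) Θ_Ψ^reg(ỹ a⁻¹, x̃⁻¹) dα`,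
the form in which the dual regular term appears in the pointwise reflection formula
`gjTruncF_one_mul_gjThetaReg_eq_reflection`. [folklore] -/
theorem integral_gjDualF_one_mul_gjThetaReg_eq_integral_inv
    (α : Measure (AdelicGroupData.gl n K).center') [α.IsInvInvariant]
    (Ψ : Matrix (Fin n) (Fin n) (AdeleRing (𝓞 K) K) → ℂ) (w : ℂ) (y₀ x₀ : (AdelicGroupData.gl n K).Adelic) :
    ∫ a : (AdelicGroupData.gl n K).center',
        gjDualF n K (fun _ => (1 : ℂ)) w (y₀ * (a : (AdelicGroupData.gl n K).Adelic) * x₀⁻¹) *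
          gjThetaReg n K Ψ y₀ ((a : (AdelicGroupData.gl n K).Adelic) * x₀⁻¹) ∂α =
      ∫ a : (AdelicGroupData.gl n K).center',
        gjDualF n K (fun _ => (1 : ℂ)) w (y₀ * ((a : (AdelicGroupData.gl n K).Adelic))⁻¹ * x₀⁻¹) *
          gjThetaReg n K Ψ (y₀ * ((a : (AdelicGroupData.gl n K).Adelic))⁻¹) x₀⁻¹ ∂α := by
  rw [← integral_inv_eq_self (μ := α)
    (fun a : (AdelicGroupData.gl n K).center' =>
      gjDualF n K (fun _ => (1 : ℂ)) w (y₀ * (a : (AdelicGroupData.gl n K).Adelic) * x₀⁻¹) *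
        gjThetaReg n K Ψ y₀ ((a : (AdelicGroupData.gl n K).Adelic) * x₀⁻¹))]
  refine integral_congr_ae (Eventually.of_forall fun a => ?_)
  exact congrArg (fun t => gjDualF n K (fun _ => (1 : ℂ)) w
      (y₀ * ((a⁻¹ : (AdelicGroupData.gl n K).center') : (AdelicGroupData.gl n K).Adelic) * x₀⁻¹) * t)
    (gjThetaReg_central_mul Ψ y₀ x₀⁻¹ (centerval_mul_comm a⁻¹))

end Kernel

end Literature.NumberTheory.Automorphic
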